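import Mathlib.Probability.Kernel.Composition.MeasureCompProd
import HarnessLib

/-!
# Disintegration of total variation — definitions

Vocabulary of the card `walls-inherit-bulk` (WB0) of the cert-ideate seat ym-19354-certideate-2 (gen 5,
`cards/Sketch-g5.lean` sha16 858e45e89aea64b7 §B), for crux `stmt-QuantumFields-19354` (`BalabanLadder.IR`);
owner READING R37 (d): «`DisintegrationTV` TRUE, size S — MAY LAND as helper (`Theorems/BalabanLadderIRDisintegrationTV.lean`,
pure `Measure.compProd`, `--supports stmt-QuantumFields-19354 --as helper`, an idle prover …)».

The two definitions are VERBATIM the sketch's (namespace kept):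

* `tv μ ν` — total variation distance in the one-sided sup form `sup_s (μ s − ν s)` over measurable `s` (symmetric for
  probability measures);
* `DisintegrationTV X Y` — the disintegration-of-TV inequality on the pair of measurable spaces `(X, Y)`: for
  probability laws `π, π'` on `X` and Markov kernels `κ, κ' : X → Y`,
  `E_π[TV(κ, κ')] ≤ TV(π ⊗ κ, π' ⊗ κ') + TV(π, π')`, stated with the lower integral so that no measurability side
  condition is smuggled in.

The theorem `disintegrationTV_of_countablyGenerated : [CountablyGenerated Y] → DisintegrationTV X Y` is proved in
`Theorems/BalabanLadderIRDisintegrationTV.lean`.  REMARK (typing datum, informal): some countability hypothesis on `Y`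
is needed — on an uncountable set with the countable–cocountable σ-algebra, the diffuse `{0,1}`-valued law `π = π'`
and the Dirac kernels `κ = δ_x`, `κ' = δ_{φ x}` (`φ` a fixed-point-free bijection) give left side `1` and right side
`0`, because every set of the product σ-algebra is decided by countably many coordinates.

ROUTE-INDEPENDENT: Mathlib only.
-/

noncomputable section

open MeasureTheory ProbabilityTheory

namespace Summit.QuantumFields.YangMills.Cruxes.IR.CertIdeate2g5

section B

variable {X Y : Type*} [MeasurableSpace X] [MeasurableSpace Y]

/-- total variation distance (one-sided sup form; symmetric for probability measures). -/
def tv (μ ν : Measure X) : ℝ :=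
  sSup {r : ℝ | ∃ s : Set X, MeasurableSet s ∧ r = (μ s).toReal - (ν s).toReal}

/-- **Disintegration-of-TV inequality (exact, size S–M).**  For probability laws `π, π'` of the frozen walls and
Markov kernels `κ, κ'` (the thin-region kernel seen from the observed cell, under the two far data):
`E_π[TV(κ, κ')] ≤ TV(π ⊗ κ, π' ⊗ κ') + TV(π, π')`.
Proof: measurable selection of a near-optimal event `A_x` for each `x`, test the joint laws on `{(x, y) | y ∈ A_x}`.
Stated with the lower integral so that no measurability side condition is smuggled in. -/
def DisintegrationTV (X Y : Type*) [MeasurableSpace X] [MeasurableSpace Y] : Prop :=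
  ∀ (π π' : Measure X) [IsProbabilityMeasure π] [IsProbabilityMeasure π']
    (κ κ' : Kernel X Y) [IsMarkovKernel κ] [IsMarkovKernel κ'],
    ∫⁻ x, ENNReal.ofReal (tv (κ x) (κ' x)) ∂π ≤
      ENNReal.ofReal (tv (π.compProd κ) (π'.compProd κ') + tv π π')

end B

end Summit.QuantumFields.YangMills.Cruxes.IR.CertIdeate2g5

end
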